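import Summits.QuantumFields.BalabanUV.Beta.CompositeMixedWardLetter
import Summits.QuantumFields.BalabanUV.Beta.CompositeMixedWardGradedSym
import Summits.QuantumFields.BalabanUV.Beta.CompositeMixedTableGradedBounds
import Summits.QuantumFields.BalabanUV.Beta.MixedWardPacking

/-!
# `BalabanUV.Beta.CompositeMixedWardClass` — row D1 ∕ (C1), PART 111: THE CLASS OF THE (W)_j MIXED LETTER's REMAINDER — the remainder forced by the letter `hM₂`
# over the GRADED composite mixed table is a VERTEX FAMILY at blocking `L^m` with constants UNIFORM in the coarse site (generic bricks, every depth), its sup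
# bound (g29's `hRMb`), the letter BY DEFINITION (g29's `hM₂`), the member-0 Λ-weight spelling, and the hypothesis-free ROOTED and SYM instances

HONEST DEPENDENCY (page 1, mandatory): continuum YM on T⁴ ⇐ BetaPertH ∧ nine spine estimates (0/9 proved); BetaPertH ⇐ (D1) ∧ (D4) ∧ CAP+tail;
G-an2-4 gates asym, D1 and NE2/3/4.  HONEST FRAMING (cell contract, verbatim): «discharging `BetaPertH` makes Bałaban's UV stability UNCONDITIONAL —
a real constructive-QFT result; it is NOT the continuum limit and NOT the Clay problem.»  ABSOLUTE RULE (cell charter, verbatim): «No internally-minted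
statement may enter as a cited fact. Every hypothesis is either kernel-proved in this package or a verbatim quotation of a PUBLISHED theorem with page
reference. The manuscript(s) under audit are NOT citable for their own disputed steps — they are the thing under adjudication; programme-internal
(2001/route/tribunal) claims are never citable.»

WHY (an2 gen 87; HWD-SCOPING §1d (i)(ii); chair leaf-03 g68 XV15's open list «bound `hRMb`, member-0 Λ-weight spelling»).  an2 g29's member-0 machinery
`WardLocusRecursiveAllSlot.divW_WrecOf_zero_of_letters` takes the MIXED letter `hM₂` with ANY remainder `RM` and a uniform sup bound `hRMb`; the j = 0 record (an1 g43
`SymMixedWardPacking`) supplies three binders for its one-step sym table: the letter BY DEFINITION (`RM := left side − datum`), the CLASS (`∃ C δ > 0, ∀ y, VertexFamily (RM y) Lc C δ`)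
and the PARITY.  PART 110g proved the parity for the graded composite mixed table `c₂ • compMixFFG … m` against `cM • compHessFF … m` (generic bricks, lock `cH·c₂ = ξ·cM`).
THIS FILE supplies the other two binders and the sup bound for the SAME written-out remainder: §1 `compMixFFG … m κ u ρ′ w` is bi-localised at the coarse point `(L^m)•w`
UNIFORMLY in the fluctuation bond (PART 91 `locStencilFM_compMixFFG` + an2 K-W1 `MixedWardPacking.biLoc_absorb`); the letter's left side `cH • Σ_{v ∈ box N} divV (κ u ↦ c₂ •
compMixFFG … κ u ρ′ w) (N•Y + v)` and its commutator datum `[cM • compHessFF … ρ′ w, diagK (ξ • Σ_v legInd ρ₀ (N•Y + v))]` are vertex families at blocking `L^m` with constants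
uniform in `Y` (any block lattice `N`, generator root `ρ₀`, weight `ξ`; F6a `vertexFamily_compHessFF`); hence **`vertexFamily_mixedLetterRemainder`**, the sup shape
**`abs_mixedLetterRemainder_le`** (= `hRMb`) and **`mixedLetter_of_remainder`** (= `hM₂`).  §2 the member-0 Λ-weight spelling `M2Of d N mixFF 0 κ u ρ w = mixFF κ u ρ w` (d-generic;
the tree's `WardMixedModelNoGo.M2Of_zero` ∕ `CombMixedT2EvenStoreyTwoLetters.M2Of_zero_apply` are `d = 3`) and the letter in `divW_WrecOf_zero_of_letters`' EXACT `hM₂` text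
(`M2Of d N (c₂ • compMixFFG …) 0`, `M 0 ρ′ w = cM • compHessFF … ρ′ w` as `SymTablesOf.tabsOf` builds it).
§3 the hypothesis-free instances: ROOTED bricks `linKerAt ∕ vhKerAt ∕ hessKerAt ∕ mixKerAt (toSite (r k)) L` (in-block root list, `1 ≤ L`; brick masses by an1's
`abs_*_le`, the root list's mixed mass bounded by the SUM of `mixAbs` over the finite box — no mass lemma needed) and the record's (0.4)-SYM bricks (root list;
the constant list gives `compMixG r L m` ∕ `compH r L m` by `rfl`).

WHAT: [folklore] finite sums ∕ triangle inequalities BY NAME over OUR typed objects; no `def`, no `def … : Prop`, nothing cited, 0 sorry.  Nothing of Bałaban's asserted,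
valued or discharged; 0 estimates; 0∕4 row-D1 binders; (W)_j NOT claimed (the mixed letter's binders {letter, class, sup bound, parity, member-0 shape} are by name in both
presentations; the record-level instantiation is (O3)-class, referee-gated); NOT (C1), NOT D1, NEVER «G-an2-4 closed», NOT BetaPertH, NOT continuum, NOT Clay.  an2 gen 87, 2026-08-30.
-/

noncomputable section

open Finset
open scoped BigOperators
open Literature.MathematicalPhysics.QuantumFieldTheory.Balaban1983to89
open Literature.MathematicalPhysics.QuantumFieldTheory.Balaban1983to89.Beta
open B12Sec2to5 (l1 l1_nonneg)
open ExpKernelCalculus (MKer comp BiLoc VertexFamily)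
open OneStepResolventKernel (Fib)
open KernelWard (divV biLoc_add biLoc_sub)
open StepJetData (biLoc_weaken biLoc_smul)
open SecondOrderResponse (LocStencilFM)
open AffineAveraging (Site box toSite unitVec)
open AveragingHessianKernels (Bond Near ell)
open AveragingHessianKernelsRooted (linKerAt vhKerAt hessKerAt hessKerAt_swap)
open AveragingMixedJetTables (mixKerAt mixAbs mixAbs_nonneg)
open BalabanStepW2 (M2Of wM2)
open Summit.QuantumFields.BalabanUV.Beta.TameKernelCalculus (trK)
open Summit.QuantumFields.BalabanUV.Beta.BorderedHessian (diagK sgnK comp_diagK_right comp_diagK_left)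
open Summit.QuantumFields.BalabanUV.Beta.AveragingWardRootedStencils (legInd legInd_apply)
open Summit.QuantumFields.BalabanUV.Beta.WardLocusStencils (divV_apply)
open Summit.QuantumFields.BalabanUV.Beta.MixedWardPacking (biLoc_absorb)
open Summit.QuantumFields.BalabanUV.Beta.CompositeVertexKernelRec
open Summit.QuantumFields.BalabanUV.Beta.CompositeHessianTable (compHessFF vertexFamily_compHessFF)
open Summit.QuantumFields.BalabanUV.Beta.CompositeMixedTable (bndMix bndMix_nonneg)
open Summit.QuantumFields.BalabanUV.Beta.CompositeMixedTableGraded (compMixKerG compMixFFG compMixG)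
open Summit.QuantumFields.BalabanUV.Beta.CompositeMixedTableGradedBounds (locStencilFM_compMixFFG)
open Summit.QuantumFields.BalabanUV.Beta.CompositeMixedWardLetter (parityOdd_mixedLetterRemainder)
open Summit.QuantumFields.BalabanUV.Beta.CompositeVertexWardRooted (linKerAt_window_dz vhKerAt_window_dz)
open Summit.QuantumFields.BalabanUV.Beta.CompositeMixedWardRootedBricks (mixKerAt_window_dz)
open Summit.QuantumFields.BalabanUV.Beta.SymAveragingHessianCounts (symLinKerAt symVhKerAt symHessKerAt symHessKerAt_swap)
open Summit.QuantumFields.BalabanUV.Beta.SymAveragingMixedJetTables (symMixKerAt symMixAbs symMixAbs_nonneg)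
open Summit.QuantumFields.BalabanUV.Beta.CompositeMixedWardGradedSym (symLinKerAt_window_dz symVhKerAt_window_dz symMixKerAt_window_dz)

namespace Summit.QuantumFields.BalabanUV.Beta.CompositeMixedWardClass

variable {d : ℕ}

/-! ## §1 Generic bricks with uniform bounds: the class of the left side, of the datum, of the remainder -/

section Generic

variable {ℓ : ℕ → Fin (d + 1) → Site (d + 1) → Bond (d + 1) → ℝ}
  {𝓋 𝒽 : ℕ → Fin (d + 1) → Site (d + 1) → Bond (d + 1) → Bond (d + 1) → ℝ}
  {𝓉 : ℕ → Fin (d + 1) → Site (d + 1) → Bond (d + 1) → Bond (d + 1) → Bond (d + 1) → ℝ} {L : ℕ}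
  {Bℓ B𝓋 B𝒽 B𝓉 : ℝ} (hB : 0 ≤ Bℓ) (hB' : 0 ≤ B𝓋) (hB'' : 0 ≤ B𝒽) (hB''' : 0 ≤ B𝓉)
  (hℓb : ∀ m μ y f, |ℓ m μ y f| ≤ Bℓ) (h𝓋b : ∀ m μ y f f', |𝓋 m μ y f f'| ≤ B𝓋) (h𝒽b : ∀ m μ y f f', |𝒽 m μ y f f'| ≤ B𝒽)
  (h𝓉b : ∀ m μ y g f f', |𝓉 m μ y g f f'| ≤ B𝓉)

include hB hB' hB'' hB''' hℓb h𝓋b h𝒽b h𝓉b in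
/-- [folklore] **THE GRADED COMPOSITE MIXED TABLE IS BI-LOCALISED AT THE COARSE POINT `(L^m)•w`, UNIFORMLY IN THE FLUCTUATION BOND** (rate `1∕2`, constant
`bndMix m · e^{3(d+1)·wid m}`): PART 91's `LocStencilFM (L^m)` letter at rate `1` with its far factor `e^{−|u − (L^m)•w|}` absorbed (`MixedWardPacking.biLoc_absorb`). -/
theorem biLoc_compMixFFG_coarse (m : ℕ) (κ : Fin (d + 1)) (u : Site (d + 1)) (ρ' : Fin (d + 1)) (w : Site (d + 1)) :
    BiLoc (compMixFFG ℓ 𝓋 𝒽 𝓉 L m κ u ρ' w) (((L ^ m : ℕ) : ℤ) • w) (((L ^ m : ℕ) : ℤ) • w)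
      (bndMix d L Bℓ B𝓋 B𝒽 B𝓉 m * Real.exp (3 * ((d : ℝ) + 1) * (wid L m) * 1)) (1 / 2) :=
  biLoc_absorb (mul_nonneg (bndMix_nonneg hB hB' hB'' hB''' m) (Real.exp_pos _).le) zero_le_one
    (locStencilFM_compMixFFG hB hB' hB'' hB''' hℓb h𝓋b h𝒽b h𝓉b m zero_le_one κ u ρ' w)

include hB hB' hB'' hB''' hℓb h𝓋b h𝒽b h𝓉b in
/-- [folklore] **ONE BLOCK-DIVERGENCE TERM IS BI-LOCALISED AT `(L^m)•w`** (any fine site `s`, scalar `c₂`): the `2(d+1)` tables of `divV (κ u ↦ c₂ • compMixFFG … κ u ρ′ w) s`. -/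
theorem biLoc_divV_compMixFFG (m : ℕ) (c₂ : ℝ) (s : Site (d + 1)) (ρ' : Fin (d + 1)) (w : Site (d + 1)) :
    BiLoc (divV (fun κ u => c₂ • compMixFFG ℓ 𝓋 𝒽 𝓉 L m κ u ρ' w) s) (((L ^ m : ℕ) : ℤ) • w) (((L ^ m : ℕ) : ℤ) • w)
      (∑ _κ : Fin (d + 1), (|c₂| * (bndMix d L Bℓ B𝓋 B𝒽 B𝓉 m * Real.exp (3 * ((d : ℝ) + 1) * (wid L m) * 1)) +
        |c₂| * (bndMix d L Bℓ B𝓋 B𝒽 B𝓉 m * Real.exp (3 * ((d : ℝ) + 1) * (wid L m) * 1)))) (1 / 2) := by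
  have h : BiLoc (fun x z a b => ∑ κ ∈ (Finset.univ : Finset (Fin (d + 1))),
      (c₂ • compMixFFG ℓ 𝓋 𝒽 𝓉 L m κ (s - B6BondElimination.unitVec κ) ρ' w - c₂ • compMixFFG ℓ 𝓋 𝒽 𝓉 L m κ s ρ' w) x z a b)
      (((L ^ m : ℕ) : ℤ) • w) (((L ^ m : ℕ) : ℤ) • w)
      (∑ _κ ∈ (Finset.univ : Finset (Fin (d + 1))), (|c₂| * (bndMix d L Bℓ B𝓋 B𝒽 B𝓉 m * Real.exp (3 * ((d : ℝ) + 1) * (wid L m) * 1)) +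
        |c₂| * (bndMix d L Bℓ B𝓋 B𝒽 B𝓉 m * Real.exp (3 * ((d : ℝ) + 1) * (wid L m) * 1)))) (1 / 2) :=
    OneStepResolventKernel.biLoc_finset_sum _ fun κ _ =>
      biLoc_sub (biLoc_smul (biLoc_compMixFFG_coarse hB hB' hB'' hB''' hℓb h𝓋b h𝒽b h𝓉b m κ _ ρ' w) c₂)
        (biLoc_smul (biLoc_compMixFFG_coarse hB hB' hB'' hB''' hℓb h𝓋b h𝒽b h𝓉b m κ _ ρ' w) c₂)
  intro x z a b
  rw [divV_apply]
  simpa only [Pi.sub_apply, Pi.smul_apply] using h x z a b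

include hB hB' hB'' hB''' hℓb h𝓋b h𝒽b h𝓉b in
/-- [folklore] **THE LETTER's LEFT SIDE IS A VERTEX FAMILY AT BLOCKING `L^m`, CONSTANT UNIFORM IN THE COARSE SITE `Y`** (any block lattice `N`, scalars `cH`, `c₂`):
every one of the `2(d+1)·|box N|` tables of `cH • Σ_{v ∈ box N} divV (κ u ↦ c₂ • compMixFFG … κ u ρ′ w) (N•Y + v)` is bi-localised at `(L^m)•w`. -/
theorem vertexFamily_wardM (N m : ℕ) (Y : Site (d + 1)) (cH c₂ : ℝ) :
    VertexFamily (fun ρ' w => cH • ∑ v ∈ box (d + 1) N, divV (fun κ u => c₂ • compMixFFG ℓ 𝓋 𝒽 𝓉 L m κ u ρ' w) ((N : ℤ) • Y + toSite v)) (L ^ m)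
      (|cH| * ∑ _v ∈ box (d + 1) N, ∑ _κ : Fin (d + 1), (|c₂| * (bndMix d L Bℓ B𝓋 B𝒽 B𝓉 m * Real.exp (3 * ((d : ℝ) + 1) * (wid L m) * 1)) +
        |c₂| * (bndMix d L Bℓ B𝓋 B𝒽 B𝓉 m * Real.exp (3 * ((d : ℝ) + 1) * (wid L m) * 1)))) (1 / 2) := by
  intro ρ' w
  have hs : BiLoc (∑ v ∈ box (d + 1) N, divV (fun κ u => c₂ • compMixFFG ℓ 𝓋 𝒽 𝓉 L m κ u ρ' w) ((N : ℤ) • Y + toSite v))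
      (((L ^ m : ℕ) : ℤ) • w) (((L ^ m : ℕ) : ℤ) • w)
      (∑ _v ∈ box (d + 1) N, ∑ _κ : Fin (d + 1), (|c₂| * (bndMix d L Bℓ B𝓋 B𝒽 B𝓉 m * Real.exp (3 * ((d : ℝ) + 1) * (wid L m) * 1)) +
        |c₂| * (bndMix d L Bℓ B𝓋 B𝒽 B𝓉 m * Real.exp (3 * ((d : ℝ) + 1) * (wid L m) * 1)))) (1 / 2) :=
    KernelWard.biLoc_finset_sum _ fun v _ => biLoc_divV_compMixFFG hB hB' hB'' hB''' hℓb h𝓋b h𝒽b h𝓉b m c₂ ((N : ℤ) • Y + toSite v) ρ' w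
  exact biLoc_smul hs cH

omit hB hB' hB'' hB''' hℓb h𝓋b h𝒽b h𝓉b in
/-- [folklore] The symbol of the block generator is bounded: `|(ξ • Σ_{v ∈ box N} legInd ρ₀ (N•Y + v)) z b| ≤ |ξ|·|box N|`. -/
theorem abs_blockGen_le (N : ℕ) (Y ρ₀ : Site (d + 1)) (ξ : ℝ) (z : Site (d + 1)) (b : Fib d) :
    |(ξ • ∑ v ∈ box (d + 1) N, legInd ρ₀ ((N : ℤ) • Y + toSite v)) z b| ≤ |ξ| * (box (d + 1) N).card := by
  simp only [Pi.smul_apply, Finset.sum_apply, smul_eq_mul]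
  rw [abs_mul]
  refine mul_le_mul_of_nonneg_left ?_ (abs_nonneg ξ)
  calc |∑ v ∈ box (d + 1) N, legInd ρ₀ ((N : ℤ) • Y + toSite v) z b|
      ≤ ∑ v ∈ box (d + 1) N, |legInd ρ₀ ((N : ℤ) • Y + toSite v) z b| := Finset.abs_sum_le_sum_abs _ _
    _ ≤ ∑ _v ∈ box (d + 1) N, (1 : ℝ) := Finset.sum_le_sum fun v _ => by
        rw [legInd_apply]; split_ifs <;> simp
    _ = (box (d + 1) N).card := by simp

include hB hB'' hℓb h𝒽b in
/-- [folklore] **THE COMMUTATOR DATUM IS A VERTEX FAMILY AT BLOCKING `L^m`, CONSTANT UNIFORM IN `Y`**: `[cM • compHessFF … ρ′ w, diagK (ξ • Σ_v legInd ρ₀ (N•Y + v))]` has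
entries `cM · Ĥ(x,z) · (D(z,b) − D(x,a))` with `|D| ≤ |ξ|·|box N|` and `Ĥ` bi-localised at `(L^m)•w` (F6a `vertexFamily_compHessFF` at rate `1∕2`). -/
theorem vertexFamily_datM (N m : ℕ) (Y ρ₀ : Site (d + 1)) (cM ξ : ℝ) :
    VertexFamily (fun ρ' w =>
        comp (cM • compHessFF ℓ 𝒽 L m ρ' w) (diagK (ξ • ∑ v ∈ box (d + 1) N, legInd ρ₀ ((N : ℤ) • Y + toSite v))) -
          comp (diagK (ξ • ∑ v ∈ box (d + 1) N, legInd ρ₀ ((N : ℤ) • Y + toSite v))) (cM • compHessFF ℓ 𝒽 L m ρ' w)) (L ^ m)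
      (|cM| * (bndVH d L Bℓ B𝒽 m * Real.exp (2 * ((d : ℝ) + 1) * (wid L m) * (1 / 2))) * (2 * (|ξ| * (box (d + 1) N).card))) (1 / 2) := by
  intro ρ' w x z a b
  dsimp only
  have hH := vertexFamily_compHessFF (ℓ := ℓ) (𝒽 := 𝒽) (L := L) hB hB'' hℓb h𝒽b m (by norm_num : (0 : ℝ) ≤ 1 / 2) ρ' w x z a b
  have hD1 := abs_blockGen_le (d := d) N Y ρ₀ ξ z b
  have hD2 := abs_blockGen_le (d := d) N Y ρ₀ ξ x a
  have e : (comp (cM • compHessFF ℓ 𝒽 L m ρ' w) (diagK (ξ • ∑ v ∈ box (d + 1) N, legInd ρ₀ ((N : ℤ) • Y + toSite v))) -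
        comp (diagK (ξ • ∑ v ∈ box (d + 1) N, legInd ρ₀ ((N : ℤ) • Y + toSite v))) (cM • compHessFF ℓ 𝒽 L m ρ' w)) x z a b =
      cM * compHessFF ℓ 𝒽 L m ρ' w x z a b *
        ((ξ • ∑ v ∈ box (d + 1) N, legInd ρ₀ ((N : ℤ) • Y + toSite v)) z b - (ξ • ∑ v ∈ box (d + 1) N, legInd ρ₀ ((N : ℤ) • Y + toSite v)) x a) := by
    rw [Pi.sub_apply, Pi.sub_apply, Pi.sub_apply, Pi.sub_apply, comp_diagK_right, comp_diagK_left]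
    simp only [Pi.smul_apply, smul_eq_mul]
    ring
  rw [e, abs_mul, abs_mul]
  have hdiff : |(ξ • ∑ v ∈ box (d + 1) N, legInd ρ₀ ((N : ℤ) • Y + toSite v)) z b -
        (ξ • ∑ v ∈ box (d + 1) N, legInd ρ₀ ((N : ℤ) • Y + toSite v)) x a| ≤ 2 * (|ξ| * (box (d + 1) N).card) := by
    refine (abs_sub _ _).trans ?_
    linarith
  have hC : 0 ≤ bndVH d L Bℓ B𝒽 m * Real.exp (2 * ((d : ℝ) + 1) * (wid L m) * (1 / 2)) := mul_nonneg (bndVH_nonneg hB hB'' m) (Real.exp_pos _).le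
  calc |cM| * |compHessFF ℓ 𝒽 L m ρ' w x z a b| *
        |(ξ • ∑ v ∈ box (d + 1) N, legInd ρ₀ ((N : ℤ) • Y + toSite v)) z b - (ξ • ∑ v ∈ box (d + 1) N, legInd ρ₀ ((N : ℤ) • Y + toSite v)) x a|
      ≤ |cM| * (bndVH d L Bℓ B𝒽 m * Real.exp (2 * ((d : ℝ) + 1) * (wid L m) * (1 / 2)) *
            Real.exp (-(1 / 2) * (l1 (x - ((L ^ m : ℕ) : ℤ) • w) + l1 (z - ((L ^ m : ℕ) : ℤ) • w)))) * (2 * (|ξ| * (box (d + 1) N).card)) := by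
        refine mul_le_mul (mul_le_mul_of_nonneg_left hH (abs_nonneg _)) hdiff (abs_nonneg _) ?_
        exact mul_nonneg (abs_nonneg _) (mul_nonneg hC (Real.exp_pos _).le)
    _ = _ := by ring

include hB hB' hB'' hB''' hℓb h𝓋b h𝒽b h𝓉b in
/-- [folklore] **THE REMAINDER FORCED BY THE MIXED LETTER IS A VERTEX FAMILY AT BLOCKING `L^m` WITH AN EXPLICIT CONSTANT UNIFORM IN THE COARSE SITE** (generic bricks with
uniform bounds; tables `c₂ • compMixFFG … m`, `cM • compHessFF … m`; any `N`, `Y`, generator root `ρ₀`, weight `ξ`, `cH`; rate `1∕2`), for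
`RM Y ρ′ w := cH • Σ_{v ∈ box N} divV (κ u ↦ c₂ • compMixFFG … κ u ρ′ w) (N•Y + v) − ([cM • compHessFF … ρ′ w, diagK (ξ • Σ_v legInd ρ₀ (N•Y + v))])`. -/
theorem vertexFamily_mixedLetterRemainder_explicit (N m : ℕ) (Y ρ₀ : Site (d + 1)) (cH c₂ cM ξ : ℝ) :
    VertexFamily (fun ρ' w =>
        cH • ∑ v ∈ box (d + 1) N, divV (fun κ u => c₂ • compMixFFG ℓ 𝓋 𝒽 𝓉 L m κ u ρ' w) ((N : ℤ) • Y + toSite v) -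
          (comp (cM • compHessFF ℓ 𝒽 L m ρ' w) (diagK (ξ • ∑ v ∈ box (d + 1) N, legInd ρ₀ ((N : ℤ) • Y + toSite v))) -
            comp (diagK (ξ • ∑ v ∈ box (d + 1) N, legInd ρ₀ ((N : ℤ) • Y + toSite v))) (cM • compHessFF ℓ 𝒽 L m ρ' w))) (L ^ m)
      (|cH| * ∑ _v ∈ box (d + 1) N, ∑ _κ : Fin (d + 1), (|c₂| * (bndMix d L Bℓ B𝓋 B𝒽 B𝓉 m * Real.exp (3 * ((d : ℝ) + 1) * (wid L m) * 1)) +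
          |c₂| * (bndMix d L Bℓ B𝓋 B𝒽 B𝓉 m * Real.exp (3 * ((d : ℝ) + 1) * (wid L m) * 1))) +
        |cM| * (bndVH d L Bℓ B𝒽 m * Real.exp (2 * ((d : ℝ) + 1) * (wid L m) * (1 / 2))) * (2 * (|ξ| * (box (d + 1) N).card))) (1 / 2) :=
  fun ρ' w => biLoc_sub (vertexFamily_wardM hB hB' hB'' hB''' hℓb h𝓋b h𝒽b h𝓉b N m Y cH c₂ ρ' w) (vertexFamily_datM hB hB'' hℓb h𝒽b N m Y ρ₀ cM ξ ρ' w)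

include hB hB' hB'' hB''' hℓb h𝓋b h𝒽b h𝓉b in
/-- [folklore] **THE CLASS BINDER OF THE MIXED LETTER's REMAINDER** (j = 0 shape `SymMixedWardPacking.vertexFamily_symRWof`, here for the graded composite mixed table at
every depth): `∃ C δ, 0 < δ ∧ ∀ Y, VertexFamily (RM Y) (L^m) C δ`. -/
theorem vertexFamily_mixedLetterRemainder (N m : ℕ) (ρ₀ : Site (d + 1)) (cH c₂ cM ξ : ℝ) :
    ∃ C δ : ℝ, 0 < δ ∧ ∀ Y : Site (d + 1), VertexFamily (fun ρ' w =>
        cH • ∑ v ∈ box (d + 1) N, divV (fun κ u => c₂ • compMixFFG ℓ 𝓋 𝒽 𝓉 L m κ u ρ' w) ((N : ℤ) • Y + toSite v) -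
          (comp (cM • compHessFF ℓ 𝒽 L m ρ' w) (diagK (ξ • ∑ v ∈ box (d + 1) N, legInd ρ₀ ((N : ℤ) • Y + toSite v))) -
            comp (diagK (ξ • ∑ v ∈ box (d + 1) N, legInd ρ₀ ((N : ℤ) • Y + toSite v))) (cM • compHessFF ℓ 𝒽 L m ρ' w))) (L ^ m) C δ :=
  ⟨_, 1 / 2, by norm_num, fun Y => vertexFamily_mixedLetterRemainder_explicit hB hB' hB'' hB''' hℓb h𝓋b h𝒽b h𝓉b N m Y ρ₀ cH c₂ cM ξ⟩

include hB hB' hB'' hB''' hℓb h𝓋b h𝒽b h𝓉b in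
/-- [folklore] **THE SUP BINDER `hRMb` OF `divW_WrecOf_zero_of_letters` FOR THE MIXED LETTER's REMAINDER**: `∃ B, ∀ Y ρ′ w x z a b, |RM Y ρ′ w x z a b| ≤ B` (the class
constant, dropping the decay factor `≤ 1`). -/
theorem abs_mixedLetterRemainder_le (N m : ℕ) (ρ₀ : Site (d + 1)) (cH c₂ cM ξ : ℝ) :
    ∃ B : ℝ, ∀ (Y : Site (d + 1)) (ρ' : Fin (d + 1)) (w x z : Site (d + 1)) (a b : Fib d),
      |(cH • ∑ v ∈ box (d + 1) N, divV (fun κ u => c₂ • compMixFFG ℓ 𝓋 𝒽 𝓉 L m κ u ρ' w) ((N : ℤ) • Y + toSite v) -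
          (comp (cM • compHessFF ℓ 𝒽 L m ρ' w) (diagK (ξ • ∑ v ∈ box (d + 1) N, legInd ρ₀ ((N : ℤ) • Y + toSite v))) -
            comp (diagK (ξ • ∑ v ∈ box (d + 1) N, legInd ρ₀ ((N : ℤ) • Y + toSite v))) (cM • compHessFF ℓ 𝒽 L m ρ' w))) x z a b| ≤ B := by
  obtain ⟨C, δ, hδ, hV⟩ := vertexFamily_mixedLetterRemainder hB hB' hB'' hB''' hℓb h𝓋b h𝒽b h𝓉b N m ρ₀ cH c₂ cM ξ
  refine ⟨C, fun Y ρ' w x z a b => ?_⟩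
  have h := hV Y ρ' w x z a b
  refine h.trans ?_
  have h1 : Real.exp (-δ * (l1 (x - ((L ^ m : ℕ) : ℤ) • w) + l1 (z - ((L ^ m : ℕ) : ℤ) • w))) ≤ 1 :=
    Real.exp_le_one_iff.mpr (by nlinarith [l1_nonneg (x - ((L ^ m : ℕ) : ℤ) • w), l1_nonneg (z - ((L ^ m : ℕ) : ℤ) • w)])
  simpa using mul_le_mul_of_nonneg_left h1 ((hV Y ρ' w).nonneg a)

omit hB hB' hB'' hB''' hℓb h𝓋b h𝒽b h𝓉b in
/-- [folklore] **THE MIXED LETTER HOLDS BY DEFINITION OF ITS REMAINDER** (g29's `hM₂` text with `RM := left side − datum`; j = 0 shape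
`SymMixedWardPacking.symWardMixed_symRWof`): `LHS = datum + (LHS − datum)`. -/
theorem mixedLetter_of_remainder (N m : ℕ) (Y ρ₀ : Site (d + 1)) (ρ' : Fin (d + 1)) (w : Site (d + 1)) (cH c₂ cM ξ : ℝ) :
    cH • ∑ v ∈ box (d + 1) N, divV (fun κ u => c₂ • compMixFFG ℓ 𝓋 𝒽 𝓉 L m κ u ρ' w) ((N : ℤ) • Y + toSite v) =
      comp (cM • compHessFF ℓ 𝒽 L m ρ' w) (diagK (ξ • ∑ v ∈ box (d + 1) N, legInd ρ₀ ((N : ℤ) • Y + toSite v))) -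
          comp (diagK (ξ • ∑ v ∈ box (d + 1) N, legInd ρ₀ ((N : ℤ) • Y + toSite v))) (cM • compHessFF ℓ 𝒽 L m ρ' w) +
        (cH • ∑ v ∈ box (d + 1) N, divV (fun κ u => c₂ • compMixFFG ℓ 𝓋 𝒽 𝓉 L m κ u ρ' w) ((N : ℤ) • Y + toSite v) -
          (comp (cM • compHessFF ℓ 𝒽 L m ρ' w) (diagK (ξ • ∑ v ∈ box (d + 1) N, legInd ρ₀ ((N : ℤ) • Y + toSite v))) -
            comp (diagK (ξ • ∑ v ∈ box (d + 1) N, legInd ρ₀ ((N : ℤ) • Y + toSite v))) (cM • compHessFF ℓ 𝒽 L m ρ' w))) := by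
  abel

end Generic
/-! ## §2 The member-0 Λ-weight spelling: the binders in `divW_WrecOf_zero_of_letters`' exact `hM₂` ∕ `hRMb` text -/

section MemberZero

/-- [folklore] **AT MEMBER `0` THE MIXED TABLE CARRIES WEIGHT `wM2 0 = 1`** (d-generic; the tree's `WardMixedModelNoGo.M2Of_zero` and
`CombMixedT2EvenStoreyTwoLetters.M2Of_zero_apply` are the `d = 3` instances): `M2Of d N mixFF 0 κ u ρ w = mixFF κ u ρ w`. -/
theorem M2Of_member_zero (N : ℕ) (mixFF : Fin (d + 1) → Site (d + 1) → Fin (d + 1) → Site (d + 1) → MKer (d + 1) (Fib d))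
    (κ : Fin (d + 1)) (u : Site (d + 1)) (ρ : Fin (d + 1)) (w : Site (d + 1)) : M2Of d N mixFF 0 κ u ρ w = mixFF κ u ρ w := by
  simp [BalabanStepW2.M2Of, BalabanStepW2.wM2]

variable {ℓ : ℕ → Fin (d + 1) → Site (d + 1) → Bond (d + 1) → ℝ}
  {𝓋 𝒽 : ℕ → Fin (d + 1) → Site (d + 1) → Bond (d + 1) → Bond (d + 1) → ℝ}
  {𝓉 : ℕ → Fin (d + 1) → Site (d + 1) → Bond (d + 1) → Bond (d + 1) → Bond (d + 1) → ℝ} {L : ℕ}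

/-- [folklore] the member-0 spelling of the letter's left side: `M2Of d N (c₂ • compMixFFG …) 0` IS `c₂ • compMixFFG …` in the block divergence. -/
theorem wardM_M2Of_zero (N m : ℕ) (Y : Site (d + 1)) (ρ' : Fin (d + 1)) (w : Site (d + 1)) (cH c₂ : ℝ) :
    cH • ∑ v ∈ box (d + 1) N, divV (fun κ u => M2Of d N (fun κ u ρ w => c₂ • compMixFFG ℓ 𝓋 𝒽 𝓉 L m κ u ρ w) 0 κ u ρ' w) ((N : ℤ) • Y + toSite v) =
      cH • ∑ v ∈ box (d + 1) N, divV (fun κ u => c₂ • compMixFFG ℓ 𝓋 𝒽 𝓉 L m κ u ρ' w) ((N : ℤ) • Y + toSite v) := by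
  simp only [M2Of_member_zero]

/-- [folklore] **`hM₂` IN `divW_WrecOf_zero_of_letters`' EXACT TEXT** (member `0`; `mixFF := c₂ • compMixFFG … m`, `M 0 ρ′ w = cM • compHessFF … m ρ′ w` as `tabsOf` builds the
multiplier tables; any block lattice `N`, coarse site `y`, generator root `ρ₀`, `ξ`, `cH 0`), with the remainder `RM y ρ′ w := left side − datum` written out. -/
theorem hM₂_member_zero (N m : ℕ) (y ρ₀ : Site (d + 1)) (ρ' : Fin (d + 1)) (w : Site (d + 1)) (cH₀ c₂ cM ξ : ℝ) :
    cH₀ • ∑ v ∈ box (d + 1) N, divV (fun κ u => M2Of d N (fun κ u ρ w => c₂ • compMixFFG ℓ 𝓋 𝒽 𝓉 L m κ u ρ w) 0 κ u ρ' w) ((N : ℤ) • y + toSite v) =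
      comp (cM • compHessFF ℓ 𝒽 L m ρ' w) (diagK (ξ • ∑ v ∈ box (d + 1) N, legInd ρ₀ ((N : ℤ) • y + toSite v))) -
          comp (diagK (ξ • ∑ v ∈ box (d + 1) N, legInd ρ₀ ((N : ℤ) • y + toSite v))) (cM • compHessFF ℓ 𝒽 L m ρ' w) +
        (cH₀ • ∑ v ∈ box (d + 1) N, divV (fun κ u => c₂ • compMixFFG ℓ 𝓋 𝒽 𝓉 L m κ u ρ' w) ((N : ℤ) • y + toSite v) -
          (comp (cM • compHessFF ℓ 𝒽 L m ρ' w) (diagK (ξ • ∑ v ∈ box (d + 1) N, legInd ρ₀ ((N : ℤ) • y + toSite v))) -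
            comp (diagK (ξ • ∑ v ∈ box (d + 1) N, legInd ρ₀ ((N : ℤ) • y + toSite v))) (cM • compHessFF ℓ 𝒽 L m ρ' w))) := by
  rw [wardM_M2Of_zero]
  abel

end MemberZero
/-! ## §3 The hypothesis-free instances: ROOTED bricks and the record's (0.4)-SYM bricks (root lists in the block, `1 ≤ L`) -/

section Rooted

variable {L : ℕ} {r : ℕ → Fin (d + 1) → ℕ}

/-- [folklore] (R) **CLASS** of the mixed letter's remainder over the ROOTED graded composite mixed table against the rooted composite Hessian table, every depth
(brick masses: an1 `abs_linKerAt_le ∕ abs_vhKerAt_le ∕ abs_hessKerAt_le ∕ abs_tTab_le`; the root list's mixed mass `≤ Σ_{ρ ∈ box} mixAbs (toSite ρ) L`). -/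
theorem vertexFamily_mixedLetterRemainder_rooted (hL : 1 ≤ L) (hr : ∀ k, r k ∈ box (d + 1) L) (N m : ℕ) (ρ₀ : Site (d + 1)) (cH c₂ cM ξ : ℝ) :
    ∃ C δ : ℝ, 0 < δ ∧ ∀ Y : Site (d + 1), VertexFamily (fun ρ' w =>
        cH • ∑ v ∈ box (d + 1) N, divV (fun κ u => c₂ • compMixFFG (fun k => linKerAt (toSite (r k)) L) (fun k => vhKerAt (toSite (r k)) L)
            (fun k => hessKerAt (toSite (r k)) L) (fun k => mixKerAt (toSite (r k)) L) L m κ u ρ' w) ((N : ℤ) • Y + toSite v) -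
          (comp (cM • compHessFF (fun k => linKerAt (toSite (r k)) L) (fun k => hessKerAt (toSite (r k)) L) L m ρ' w)
              (diagK (ξ • ∑ v ∈ box (d + 1) N, legInd ρ₀ ((N : ℤ) • Y + toSite v))) -
            comp (diagK (ξ • ∑ v ∈ box (d + 1) N, legInd ρ₀ ((N : ℤ) • Y + toSite v)))
              (cM • compHessFF (fun k => linKerAt (toSite (r k)) L) (fun k => hessKerAt (toSite (r k)) L) L m ρ' w))) (L ^ m) C δ :=
  vertexFamily_mixedLetterRemainder (ℓ := fun k => linKerAt (toSite (r k)) L) (𝓋 := fun k => vhKerAt (toSite (r k)) L)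
    (𝒽 := fun k => hessKerAt (toSite (r k)) L) (𝓉 := fun k => mixKerAt (toSite (r k)) L)
    (Bℓ := (ell (d + 1) L : ℝ)) (B𝓋 := 3 * (ell (d + 1) L : ℝ) ^ 2) (B𝒽 := 2 * (ell (d + 1) L : ℝ) ^ 2) (B𝓉 := ∑ ρ ∈ box (d + 1) L, mixAbs (toSite ρ) L)
    (by positivity) (by positivity) (by positivity) (Finset.sum_nonneg fun ρ _ => mixAbs_nonneg _ _)
    (fun k μ y f => AveragingHessianKernelsRooted.abs_linKerAt_le hL μ y (hr k) f)
    (fun k μ y f f' => AveragingHessianKernelsRooted.abs_vhKerAt_le hL μ y (hr k) f f')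
    (fun k μ y f f' => AveragingHessianKernelsRooted.abs_hessKerAt_le hL μ y (hr k) f f')
    (fun k μ y g f f' => (AveragingMixedJetTables.abs_tTab_le (hr k) μ y f f' g).trans
      (Finset.single_le_sum (f := fun ρ => mixAbs (toSite ρ) L) (fun ρ _ => mixAbs_nonneg _ _) (hr k))) N m ρ₀ cH c₂ cM ξ

/-- [folklore] (R) **SUP BINDER `hRMb`** for the rooted instance. -/
theorem abs_mixedLetterRemainder_le_rooted (hL : 1 ≤ L) (hr : ∀ k, r k ∈ box (d + 1) L) (N m : ℕ) (ρ₀ : Site (d + 1)) (cH c₂ cM ξ : ℝ) :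
    ∃ B : ℝ, ∀ (Y : Site (d + 1)) (ρ' : Fin (d + 1)) (w x z : Site (d + 1)) (a b : Fib d),
      |(cH • ∑ v ∈ box (d + 1) N, divV (fun κ u => c₂ • compMixFFG (fun k => linKerAt (toSite (r k)) L) (fun k => vhKerAt (toSite (r k)) L)
            (fun k => hessKerAt (toSite (r k)) L) (fun k => mixKerAt (toSite (r k)) L) L m κ u ρ' w) ((N : ℤ) • Y + toSite v) -
          (comp (cM • compHessFF (fun k => linKerAt (toSite (r k)) L) (fun k => hessKerAt (toSite (r k)) L) L m ρ' w)
              (diagK (ξ • ∑ v ∈ box (d + 1) N, legInd ρ₀ ((N : ℤ) • Y + toSite v))) -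
            comp (diagK (ξ • ∑ v ∈ box (d + 1) N, legInd ρ₀ ((N : ℤ) • Y + toSite v)))
              (cM • compHessFF (fun k => linKerAt (toSite (r k)) L) (fun k => hessKerAt (toSite (r k)) L) L m ρ' w))) x z a b| ≤ B :=
  abs_mixedLetterRemainder_le (ℓ := fun k => linKerAt (toSite (r k)) L) (𝓋 := fun k => vhKerAt (toSite (r k)) L)
    (𝒽 := fun k => hessKerAt (toSite (r k)) L) (𝓉 := fun k => mixKerAt (toSite (r k)) L)
    (Bℓ := (ell (d + 1) L : ℝ)) (B𝓋 := 3 * (ell (d + 1) L : ℝ) ^ 2) (B𝒽 := 2 * (ell (d + 1) L : ℝ) ^ 2) (B𝓉 := ∑ ρ ∈ box (d + 1) L, mixAbs (toSite ρ) L)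
    (by positivity) (by positivity) (by positivity) (Finset.sum_nonneg fun ρ _ => mixAbs_nonneg _ _)
    (fun k μ y f => AveragingHessianKernelsRooted.abs_linKerAt_le hL μ y (hr k) f)
    (fun k μ y f f' => AveragingHessianKernelsRooted.abs_vhKerAt_le hL μ y (hr k) f f')
    (fun k μ y f f' => AveragingHessianKernelsRooted.abs_hessKerAt_le hL μ y (hr k) f f')
    (fun k μ y g f f' => (AveragingMixedJetTables.abs_tTab_le (hr k) μ y f f' g).trans
      (Finset.single_le_sum (f := fun ρ => mixAbs (toSite ρ) L) (fun ρ _ => mixAbs_nonneg _ _) (hr k))) N m ρ₀ cH c₂ cM ξ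

/-- [folklore] (R) **PARITY** of the same remainder (PART 110g at the rooted bricks: window laws PART 105a `linKerAt_window_dz` ∕ `vhKerAt_window_dz`, PART 110c
`mixKerAt_window_dz`, antisymmetry `hessKerAt_swap`; composed root `Σ_{k<m} L^k • toSite (r k)`), under the lock `cH·c₂ = ξ·cM`. -/
theorem parityOdd_mixedLetterRemainder_rooted (hL : 1 ≤ L) (hr : ∀ k, r k ∈ box (d + 1) L) (N m : ℕ) (Y ρ₀ : Site (d + 1)) (ρ' : Fin (d + 1))
    (w : Site (d + 1)) {cH c₂ cM ξ : ℝ} (hlock : cH * c₂ = ξ * cM) :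
    trK (cH • ∑ v ∈ box (d + 1) N, divV (fun κ u => c₂ • compMixFFG (fun k => linKerAt (toSite (r k)) L) (fun k => vhKerAt (toSite (r k)) L)
            (fun k => hessKerAt (toSite (r k)) L) (fun k => mixKerAt (toSite (r k)) L) L m κ u ρ' w) ((N : ℤ) • Y + toSite v) -
        (comp (cM • compHessFF (fun k => linKerAt (toSite (r k)) L) (fun k => hessKerAt (toSite (r k)) L) L m ρ' w)
            (diagK (ξ • ∑ v ∈ box (d + 1) N, legInd ρ₀ ((N : ℤ) • Y + toSite v))) -
          comp (diagK (ξ • ∑ v ∈ box (d + 1) N, legInd ρ₀ ((N : ℤ) • Y + toSite v)))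
            (cM • compHessFF (fun k => linKerAt (toSite (r k)) L) (fun k => hessKerAt (toSite (r k)) L) L m ρ' w))) =
      -sgnK (cH • ∑ v ∈ box (d + 1) N, divV (fun κ u => c₂ • compMixFFG (fun k => linKerAt (toSite (r k)) L) (fun k => vhKerAt (toSite (r k)) L)
            (fun k => hessKerAt (toSite (r k)) L) (fun k => mixKerAt (toSite (r k)) L) L m κ u ρ' w) ((N : ℤ) • Y + toSite v) -
        (comp (cM • compHessFF (fun k => linKerAt (toSite (r k)) L) (fun k => hessKerAt (toSite (r k)) L) L m ρ' w)
            (diagK (ξ • ∑ v ∈ box (d + 1) N, legInd ρ₀ ((N : ℤ) • Y + toSite v))) -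
          comp (diagK (ξ • ∑ v ∈ box (d + 1) N, legInd ρ₀ ((N : ℤ) • Y + toSite v)))
            (cM • compHessFF (fun k => linKerAt (toSite (r k)) L) (fun k => hessKerAt (toSite (r k)) L) L m ρ' w))) :=
  parityOdd_mixedLetterRemainder (ρ := fun k => toSite (r k)) (R := fun m => ∑ i ∈ Finset.range m, ((L ^ i : ℕ) : ℤ) • toSite (r i))
    (by simp) (fun m => by rw [Finset.sum_range_succ]) (fun k μ y G => linKerAt_window_dz hL (hr k) μ y G)
    (fun k μ y f G => vhKerAt_window_dz hL (hr k) μ y f G) (fun k μ y f f' G => mixKerAt_window_dz hL (hr k) μ y f f' G)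
    (fun k μ y f f' => hessKerAt_swap (toSite (r k)) L μ y f f') N m Y ρ₀ ρ' w hlock

end Rooted

section Sym

variable {L : ℕ} {r : ℕ → Fin (d + 1) → ℕ}

/-- [folklore] (S) **CLASS** of the mixed letter's remainder over the graded composite mixed table of the record's (0.4)-SYM bricks (root list `r k` in the block; the
constant list `fun _ => r` gives `compMixG r L m` and `CompositeOneShotJets.compH r L m` by `rfl`), every depth (brick masses an1 `abs_symLinKerAt_le ∕ …`, `abs_symTTab_le`;
the finite root set's mixed mass is bounded by the sum of `symMixAbs` over the box). -/
theorem vertexFamily_mixedLetterRemainder_sym (hL : 1 ≤ L) (hr : ∀ k, r k ∈ box (d + 1) L) (N m : ℕ) (ρ₀ : Site (d + 1)) (cH c₂ cM ξ : ℝ) :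
    ∃ C δ : ℝ, 0 < δ ∧ ∀ Y : Site (d + 1), VertexFamily (fun ρ' w =>
        cH • ∑ v ∈ box (d + 1) N, divV (fun κ u => c₂ • compMixFFG (fun k => symLinKerAt (toSite (r k)) L) (fun k => symVhKerAt (toSite (r k)) L)
            (fun k => symHessKerAt (toSite (r k)) L) (fun k => symMixKerAt (toSite (r k)) L) L m κ u ρ' w) ((N : ℤ) • Y + toSite v) -
          (comp (cM • compHessFF (fun k => symLinKerAt (toSite (r k)) L) (fun k => symHessKerAt (toSite (r k)) L) L m ρ' w)
              (diagK (ξ • ∑ v ∈ box (d + 1) N, legInd ρ₀ ((N : ℤ) • Y + toSite v))) -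
            comp (diagK (ξ • ∑ v ∈ box (d + 1) N, legInd ρ₀ ((N : ℤ) • Y + toSite v)))
              (cM • compHessFF (fun k => symLinKerAt (toSite (r k)) L) (fun k => symHessKerAt (toSite (r k)) L) L m ρ' w))) (L ^ m) C δ :=
  vertexFamily_mixedLetterRemainder (ℓ := fun k => symLinKerAt (toSite (r k)) L) (𝓋 := fun k => symVhKerAt (toSite (r k)) L)
    (𝒽 := fun k => symHessKerAt (toSite (r k)) L) (𝓉 := fun k => symMixKerAt (toSite (r k)) L)
    (Bℓ := (ell (d + 1) L : ℝ)) (B𝓋 := 3 * (ell (d + 1) L : ℝ) ^ 2) (B𝒽 := 2 * (ell (d + 1) L : ℝ) ^ 2)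
    (B𝓉 := ∑ ρ ∈ box (d + 1) L, symMixAbs (toSite ρ) L)
    (by positivity) (by positivity) (by positivity) (Finset.sum_nonneg fun ρ _ => symMixAbs_nonneg _ _)
    (fun _ μ y f => SymAveragingHessianCounts.abs_symLinKerAt_le hL μ y (hr _) f)
    (fun _ μ y f f' => SymAveragingHessianCounts.abs_symVhKerAt_le hL μ y (hr _) f f')
    (fun _ μ y f f' => SymAveragingHessianCounts.abs_symHessKerAt_le hL μ y (hr _) f f')
    (fun k μ y g f f' => (SymAveragingMixedJetTables.abs_symTTab_le (hr k) μ y f f' g).trans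
      (Finset.single_le_sum (f := fun ρ => symMixAbs (toSite ρ) L) (fun ρ _ => symMixAbs_nonneg _ _) (hr k))) N m ρ₀ cH c₂ cM ξ

/-- [folklore] (S) **SUP BINDER `hRMb`** for the sym instance. -/
theorem abs_mixedLetterRemainder_le_sym (hL : 1 ≤ L) (hr : ∀ k, r k ∈ box (d + 1) L) (N m : ℕ) (ρ₀ : Site (d + 1)) (cH c₂ cM ξ : ℝ) :
    ∃ B : ℝ, ∀ (Y : Site (d + 1)) (ρ' : Fin (d + 1)) (w x z : Site (d + 1)) (a b : Fib d),
      |(cH • ∑ v ∈ box (d + 1) N, divV (fun κ u => c₂ • compMixFFG (fun k => symLinKerAt (toSite (r k)) L) (fun k => symVhKerAt (toSite (r k)) L)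
            (fun k => symHessKerAt (toSite (r k)) L) (fun k => symMixKerAt (toSite (r k)) L) L m κ u ρ' w) ((N : ℤ) • Y + toSite v) -
          (comp (cM • compHessFF (fun k => symLinKerAt (toSite (r k)) L) (fun k => symHessKerAt (toSite (r k)) L) L m ρ' w)
              (diagK (ξ • ∑ v ∈ box (d + 1) N, legInd ρ₀ ((N : ℤ) • Y + toSite v))) -
            comp (diagK (ξ • ∑ v ∈ box (d + 1) N, legInd ρ₀ ((N : ℤ) • Y + toSite v)))
              (cM • compHessFF (fun k => symLinKerAt (toSite (r k)) L) (fun k => symHessKerAt (toSite (r k)) L) L m ρ' w))) x z a b| ≤ B := by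
  obtain ⟨C, δ, hδ, hV⟩ := vertexFamily_mixedLetterRemainder_sym hL hr N m ρ₀ cH c₂ cM ξ
  refine ⟨C, fun Y ρ' w x z a b => ?_⟩
  have h := hV Y ρ' w x z a b
  refine h.trans ?_
  have h1 : Real.exp (-δ * (l1 (x - ((L ^ m : ℕ) : ℤ) • w) + l1 (z - ((L ^ m : ℕ) : ℤ) • w))) ≤ 1 :=
    Real.exp_le_one_iff.mpr (by nlinarith [l1_nonneg (x - ((L ^ m : ℕ) : ℤ) • w), l1_nonneg (z - ((L ^ m : ℕ) : ℤ) • w)])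
  simpa using mul_le_mul_of_nonneg_left h1 ((hV Y ρ' w).nonneg a)

/-- [folklore] (S) **PARITY** of the same remainder (PART 110g at the sym bricks: PART 110d's window laws `symLinKerAt_window_dz` ∕ `symVhKerAt_window_dz` ∕
`symMixKerAt_window_dz`, antisymmetry `symHessKerAt_swap`), under the lock `cH·c₂ = ξ·cM`. -/
theorem parityOdd_mixedLetterRemainder_sym (hL : 1 ≤ L) (hr : ∀ k, r k ∈ box (d + 1) L) (N m : ℕ) (Y ρ₀ : Site (d + 1)) (ρ' : Fin (d + 1))
    (w : Site (d + 1)) {cH c₂ cM ξ : ℝ} (hlock : cH * c₂ = ξ * cM) :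
    trK (cH • ∑ v ∈ box (d + 1) N, divV (fun κ u => c₂ • compMixFFG (fun k => symLinKerAt (toSite (r k)) L) (fun k => symVhKerAt (toSite (r k)) L)
            (fun k => symHessKerAt (toSite (r k)) L) (fun k => symMixKerAt (toSite (r k)) L) L m κ u ρ' w) ((N : ℤ) • Y + toSite v) -
        (comp (cM • compHessFF (fun k => symLinKerAt (toSite (r k)) L) (fun k => symHessKerAt (toSite (r k)) L) L m ρ' w)
            (diagK (ξ • ∑ v ∈ box (d + 1) N, legInd ρ₀ ((N : ℤ) • Y + toSite v))) -
          comp (diagK (ξ • ∑ v ∈ box (d + 1) N, legInd ρ₀ ((N : ℤ) • Y + toSite v)))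
            (cM • compHessFF (fun k => symLinKerAt (toSite (r k)) L) (fun k => symHessKerAt (toSite (r k)) L) L m ρ' w))) =
      -sgnK (cH • ∑ v ∈ box (d + 1) N, divV (fun κ u => c₂ • compMixFFG (fun k => symLinKerAt (toSite (r k)) L) (fun k => symVhKerAt (toSite (r k)) L)
            (fun k => symHessKerAt (toSite (r k)) L) (fun k => symMixKerAt (toSite (r k)) L) L m κ u ρ' w) ((N : ℤ) • Y + toSite v) -
        (comp (cM • compHessFF (fun k => symLinKerAt (toSite (r k)) L) (fun k => symHessKerAt (toSite (r k)) L) L m ρ' w)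
            (diagK (ξ • ∑ v ∈ box (d + 1) N, legInd ρ₀ ((N : ℤ) • Y + toSite v))) -
          comp (diagK (ξ • ∑ v ∈ box (d + 1) N, legInd ρ₀ ((N : ℤ) • Y + toSite v)))
            (cM • compHessFF (fun k => symLinKerAt (toSite (r k)) L) (fun k => symHessKerAt (toSite (r k)) L) L m ρ' w))) :=
  parityOdd_mixedLetterRemainder (ρ := fun k => toSite (r k)) (R := fun m => ∑ i ∈ Finset.range m, ((L ^ i : ℕ) : ℤ) • toSite (r i))
    (by simp) (fun m => by rw [Finset.sum_range_succ]) (fun k μ y G => symLinKerAt_window_dz hL (hr k) μ y G)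
    (fun k μ y f G => symVhKerAt_window_dz hL (hr k) μ y f G) (fun k μ y f f' G => symMixKerAt_window_dz hL (hr k) μ y f f' G)
    (fun k μ y f f' => symHessKerAt_swap (toSite (r k)) L μ y f f') N m Y ρ₀ ρ' w hlock

end Sym

end Summit.QuantumFields.BalabanUV.Beta.CompositeMixedWardClass

end
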